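import Mathlib
import Summits.MatrixMultiplication.MatrixMultiplication.Theorems.FidelityWitnessesFidelityGapThreeSeventeenStubFatBorderApolarityForms
import Summits.MatrixMultiplication.MatrixMultiplication.Theorems.FidelityWitnessesFidelityGapThreeSeventeenStubBorelFixedApolarityDiagonal
import Summits.MatrixMultiplication.MatrixMultiplication.Theorems.FidelityWitnessesFidelityGapThreeSeventeenPunctualDefs

/-!
# Borel-fixed border apolarity at `(⟨3,3,3⟩, 17)` — part 10: Slip limits are closed under
# degreewise limits

Crux `stmt-MatrixMultiplication-4958` (`FidelityWitnesses.FidelityGapThreeSeventeen`), line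
`punctual-saturation`, stub `stub_borelFixedApolarity` (helper file for the Borel normal form half).

**`SlipClosed.isSlipLimit_of_limit`** (registered as `stub_borelFixedApolarity_slipClosed`): if every
piece `I'_D` of an ideal `I'` consists of coefficientwise limits `f = lim_j F_j` of elements
`F_j ∈ (J_j)_D` of a SEQUENCE OF SLIP LIMITS `J_j`, then `I'` is a Slip limit.  This is the closedness of
`IsSlipLimit` along the Borel degenerations `J_j = g(s_j) · I` (`s_j → ∞`) of the normal form
(Buczyńska–Buczyński 2021 Thm 4.3 / CHL 2023 §2.4 in the line's sequential language): choose a Slip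
witness of each `J_j`, a basis of each piece `I'_D` (countably many requirements), and a DIAGONAL
`k = k(j)` serving all of them (part 8); general `f ∈ I'_D` follow by linearity.  Coefficientwise
convergence inside a piece `S_D` is convergence of the finitely many coefficients on the monomials of
weight `D` (`SlipClosed.coeffTendsto_iff_tendsto`).  Everything proved.
-/

noncomputable section

namespace Summit.MatrixMultiplication.MatrixMultiplication.Theorems.PunctualSaturation

-- single-conjunct summit: the `Summit.<S>.<P>` prefix repeats `MatrixMultiplication` by design (D-0017)
set_option linter.dupNamespace false

open scoped BigOperators Topology
open MvPolynomial Module Filter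
open Summit.MatrixMultiplication.MatrixMultiplication.Theorems.SymbolicSquare.FatBorder

namespace SlipClosed

/-! ## Coefficientwise convergence inside a piece -/

/-- Coefficients of an element of `S_D` off the monomials of weight `D` vanish. [folklore] -/
theorem coeff_eq_zero_of_mem_SD {D : Fin 3 → ℕ} {f : S} (hf : f ∈ SD D) {e : Var →₀ ℕ}
    (he : e ∉ monSet wt D) : coeff e f = 0 := by
  by_contra hne
  exact he ((mem_monSet_iff wt D (fun v : Var => by simp [wt])).2 (hf hne))

/-- **Inside a piece, coefficientwise convergence is convergence of the coefficient vector on the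
monomials of weight `D`** (a finite product). [folklore] -/
theorem coeffTendsto_iff_tendsto {D : Fin 3 → ℕ} {fseq : ℕ → S} {f : S} (hseq : ∀ k, fseq k ∈ SD D)
    (hf : f ∈ SD D) :
    CoeffTendsto fseq f ↔ Tendsto (fun k => fun d : Mon wt D => coeff d.1 (fseq k)) atTop
      (𝓝 fun d : Mon wt D => coeff d.1 f) := by
  rw [tendsto_pi_nhds]
  constructor
  · intro h d; exact h d.1
  · intro h e
    by_cases he : e ∈ monSet wt D
    · exact h ⟨e, he⟩
    · have h0 : (fun k => coeff e (fseq k)) = fun _ => coeff e f := by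
        funext k; rw [coeff_eq_zero_of_mem_SD (hseq k) he, coeff_eq_zero_of_mem_SD hf he]
      rw [h0]; exact tendsto_const_nhds

/-- Coefficientwise convergence is preserved by finite linear combinations. [folklore] -/
theorem coeffTendsto_sum {ι : Type*} (s : Finset ι) (c : ι → ℂ) {fseq : ι → ℕ → S} {f : ι → S}
    (h : ∀ i ∈ s, CoeffTendsto (fseq i) (f i)) :
    CoeffTendsto (fun k => ∑ i ∈ s, c i • fseq i k) (∑ i ∈ s, c i • f i) := by
  intro e
  simp only [coeff_sum, coeff_smul, smul_eq_mul]
  exact tendsto_finsetSum _ fun i hi => (h i hi e).const_mul _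

/-! ## A limit of Slip limits is a Slip limit -/

/-- **Slip limits are closed under degreewise limits**: if every element of every piece `I'_D` is a
coefficientwise limit of elements of the `D`-pieces of a sequence of Slip limits `J_j`, then `I'` is a
Slip limit. [cite: BuczynskaBuczynski2021, Thm 4.3] -/
theorem isSlipLimit_of_limit (I' : Ideal S) (J : ℕ → Ideal S) (hJ : ∀ j, IsSlipLimit (J j))
    (happrox : ∀ D, ∀ f ∈ piece I' D, ∃ F : ℕ → S, (∀ j, F j ∈ piece (J j) D) ∧ CoeffTendsto F f) :
    IsSlipLimit I' := by
  classical
  -- Slip witnesses of the `J j`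
  choose Γ hΓ using hJ
  -- the pieces are finite-dimensional; a basis of each
  haveI hfin : ∀ D : Fin 3 → ℕ, Module.Finite ℂ (SD D) := fun D =>
    Literature.RingTheory.MvPolynomial.finite_weightedHomogeneousSubmodule_of_ne_zero wt
      (fun v h => by have := congr_fun h v.1; simp [wt] at this) D
  haveI : ∀ D : Fin 3 → ℕ, Module.Finite ℂ (piece I' D) := fun D =>
    Module.Finite.of_injective (Submodule.inclusion (inf_le_right : piece I' D ≤ SD D))
      (Submodule.inclusion_injective _)
  let b : ∀ D : Fin 3 → ℕ, Basis (Fin (finrank ℂ (piece I' D))) ℂ (piece I' D) :=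
    fun D => Module.finBasis ℂ (piece I' D)
  -- the countably many requirements: `(D, i)`
  let ι : Type := Σ D : Fin 3 → ℕ, Fin (finrank ℂ (piece I' D))
  have hreq : ∀ n : ι, ∃ F : ℕ → S, (∀ j, F j ∈ piece (J j) n.1) ∧
      CoeffTendsto F (b n.1 n.2 : S) := fun n => happrox n.1 _ (b n.1 n.2).2
  choose F hF hFlim using hreq
  have hy : ∀ (n : ι) (j : ℕ), ∃ y : ℕ → S, (∀ k, y k ∈ vanishPiece (Γ j k) n.1) ∧
      CoeffTendsto y (F n j) := fun n j => (hΓ j).2 n.1 _ (hF n j)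
  choose y hy hylim using hy
  -- pass to coefficient vectors and extract a diagonal
  have hFD : ∀ n j, F n j ∈ SD n.1 := fun n j => (hF n j).2
  have hyD : ∀ n j k, y n j k ∈ SD n.1 := fun n j k => (hy n j k).2
  have hbD : ∀ n : ι, (b n.1 n.2 : S) ∈ SD n.1 := fun n => (b n.1 n.2).2.2
  obtain ⟨k, hk⟩ := Diagonal.exists_forall_tendsto_of_countable
    (M := fun n : ι => Mon wt n.1 → ℂ)
    (fun n => fun d : Mon wt n.1 => coeff d.1 (b n.1 n.2 : S))
    (fun n j => fun d : Mon wt n.1 => coeff d.1 (F n j))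
    (fun n j k => fun d : Mon wt n.1 => coeff d.1 (y n j k))
    (fun n => (coeffTendsto_iff_tendsto (hFD n) (hbD n)).1 (hFlim n))
    (fun n j => (coeffTendsto_iff_tendsto (hyD n j) (hFD n j)).1 (hylim n j))
  -- the diagonal witness
  refine ⟨fun j => Γ j (k j), fun j => (hΓ j).1 (k j), fun D f hf => ?_⟩
  have hbasic : ∀ i, CoeffTendsto (fun j => y ⟨D, i⟩ j (k j)) (b D i : S) := fun i =>
    (coeffTendsto_iff_tendsto (fun j => hyD ⟨D, i⟩ j (k j)) (hbD ⟨D, i⟩)).2 (hk ⟨D, i⟩)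
  -- expand `f` in the basis
  set c : Fin (finrank ℂ (piece I' D)) → ℂ := fun i => (b D).repr ⟨f, hf⟩ i with hc
  have hfsum : f = ∑ i, c i • (b D i : S) := by
    have h := (b D).sum_repr ⟨f, hf⟩
    have h' := congrArg (fun x : piece I' D => (x : S)) h
    simp only [Submodule.coe_sum, Submodule.coe_smul] at h'
    exact h'.symm
  refine ⟨fun j => ∑ i, c i • y ⟨D, i⟩ j (k j), fun j => ?_, ?_⟩
  · exact Submodule.sum_mem _ fun i _ => Submodule.smul_mem _ _ (hy ⟨D, i⟩ j (k j))
  · rw [hfsum]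
    exact coeffTendsto_sum _ c fun i _ => hbasic i

end SlipClosed

/-- **Registered sub-goal `stub_borelFixedApolarity_slipClosed` of `stub_borelFixedApolarity`**: a
degreewise coefficientwise limit of Slip limits is a Slip limit. [cite: BuczynskaBuczynski2021, Thm 4.3] -/
theorem stub_borelFixedApolarity_slipClosed :
    ∀ (I' : Ideal S) (J : ℕ → Ideal S), (∀ j, IsSlipLimit (J j)) →
      (∀ D, ∀ f ∈ piece I' D, ∃ F : ℕ → S, (∀ j, F j ∈ piece (J j) D) ∧ CoeffTendsto F f) →
      IsSlipLimit I' :=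
  fun I' J hJ happrox => SlipClosed.isSlipLimit_of_limit I' J hJ happrox

end Summit.MatrixMultiplication.MatrixMultiplication.Theorems.PunctualSaturation

end
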